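import Literature.Geometry.Kaehler.SiegelTorusThetaDivisorProduct
import Literature.Geometry.Kaehler.ComplexTorusIsomorphism
import Literature.Geometry.Kaehler.ComplexTorusReindex
import Literature.Geometry.Kaehler.ComplexTorusProduct
import HarnessLib

/-!
# `X_{Ω₁ ⊕ Ω₂} ≅ X_{Ω₁} × X_{Ω₂}`: the Siegel torus of a decomposable period matrix is the product torus

Layer `Literature/Geometry/Kaehler`, namespace `Literature.Geometry.Kaehler.ComplexTorus` (lane
`lit-hodgefound`, Layer A4, theta-divisor row, validation instance "products"). Sequel of
`SiegelTorusThetaDivisorProduct.lean` (`Θ = p₁⁻¹Θ₁ ∪ p₂⁻¹Θ₂` on the Siegel torus `X_Ω` of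
`Ω = Ω₁ ⊕ Ω₂`, the projections `pᵢ` being coordinate restrictions), of `ComplexTorusIsomorphism.lean`
(`IsIsomorphic`, `isIsomorphic_of_matrix`: a unimodular integer matrix with `ℂ`-linear analytic
representation presents ISOMORPHIC tori) and of `ComplexTorusReindex.lean` (the permutation matrices
`reindexMatrix e`, `reindexMatrixInv e` of a relabelling `e` of lattice coordinates; their two inverse
identities are reproved here in three lines each rather than imported from
`ComplexTorusIsogenousCMPower.lean` / `ComplexTorusProductPowerIsomorphisms.lean`, to keep the
imports of this file free of the CM and Hom-rank machinery).

The two presentations. The tree's abstract product of `X₁ = X_{Ω₁} = ComplexTorus Φ₁` and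
`X₂ = X_{Ω₂} = ComplexTorus Φ₂` is `ComplexTorus (prodPeriod Φ₁ Φ₂)` on the ambient space
`ℂ^{n₁} × ℂ^{n₂}` with lattice coordinates `(Fin n₁ ⊕ Fin n₁) ⊕ (Fin n₂ ⊕ Fin n₂)` (`ComplexTorusProduct.lean`:
"`X × X' = V × V'/Λ × Λ'`", Lange §1.1.2), whereas the Siegel torus `X_Ω = ComplexTorus Φ` of the block
period matrix lives on `ℂ^{n₁+n₂}` with coordinates `Fin (n₁+n₂) ⊕ Fin (n₁+n₂)`. This file records, once,
that they are the same complex torus: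

* **`isIsomorphic_prodPeriod_of_blockDiag`** — `X_{Ω₁ ⊕ Ω₂} ≅ X_{Ω₁} × X_{Ω₂}` as complex tori
  (`IsIsomorphic`: a biholomorphic group isomorphism); the rational representation is the permutation
  matrix of the relabelling `e` of lattice coordinates
  (`(Fin (n₁+n₂) ⊕ Fin (n₁+n₂)) ≃ ((Fin n₁ ⊕ Fin n₁) ⊕ (Fin n₂ ⊕ Fin n₂))`, spelled with
  `finSumFinEquiv` and `Equiv.sumSumSumComm`), the analytic representation is the `ℂ`-linear
  `z ↦ (z|_{ℂ^{n₁}}, z|_{ℂ^{n₂}})`;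
* `prodHomeomorph_mapMatrix_reindexMatrix` — under this isomorphism followed by the tautological
  `prodHomeomorph : X₁ × X₂ ≃ₜ X₁ × X₂` a point `x` goes to `(p₁ x, p₂ x)`, the pair of coordinate
  projections of `SiegelTorusThetaDivisorProduct.lean` (`mapMatrix` of the `0/1` matrices);
  `bijective_prodProjections` — `x ↦ (p₁ x, p₂ x)` is a bijection `X_Ω → X₁ × X₂`;
* **`siegelTwoForm_blockDiag_eq_prodForm`** — its analytic representation pulls the product polarisation
  `p₁^*E_{Ω₁} + p₂^*E_{Ω₂}` (`prodForm`) back to the principal polarisation `E_Ω`: an isomorphism of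
  (principally) POLARISED abelian varieties `(X_Ω, E_Ω) ≅ (X_{Ω₁}, E_{Ω₁}) × (X_{Ω₂}, E_{Ω₂})`;
* **`image_thetaDivisor_blockDiag`** — the isomorphism carries the theta divisor of `X_{Ω₁ ⊕ Ω₂}` onto
  `Θ₁ ×ˢ X₂ ∪ X₁ ×ˢ Θ₂`: "if `(A, Θ) = (A′, Θ′) × (A″, Θ″)`, then the theta divisor
  `Θ = (Θ′ × A″) ∪ (A′ × Θ″)`" (Grushevsky–Xie, Remark 6.2), now literally inside the product
  `ComplexTorus Φ₁ × ComplexTorus Φ₂`; `preimage_thetaDivisor_prod_union` is the same as a preimage.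

Theorems only; no definitions, no named facts, net debt `0`.

## References

* [GrushevskyXie2025] S. Grushevsky, Y. Xie, *Integrable systems approach to the Schottky problem and
  related questions*, arXiv:2504.20243 (2025), Remark 6.2 (held text `paper:arxiv-2504.20243`, p0034).
* [Lange2023AbelianVarietiesComplex] H. Lange, *Abelian Varieties over the Complex Numbers* (2023),
  §1.1.2 (`X × X' = V × V'/Λ × Λ'`, (1.2)), §1.1.6 Exercise (5)(b) (isomorphism classes), held copy
  `book:lange1992-complex-abelian-varieties` pp. 19–21, 27.
-/

noncomputable section

open scoped Manifold Topology
open Set Function Complex Matrix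
open Literature.Analysis.SpecialFunctions

namespace Literature.Geometry.Kaehler

namespace ComplexTorus

section Product

variable {n₁ n₂ : ℕ} (Ω₁ : Matrix (Fin n₁) (Fin n₁) ℂ) (Ω₂ : Matrix (Fin n₂) (Fin n₂) ℂ)
  {Ω : Matrix (Fin (n₁ + n₂)) (Fin (n₁ + n₂)) ℂ}
  (hΩb : Ω = Matrix.reindex finSumFinEquiv finSumFinEquiv (Matrix.fromBlocks Ω₁ 0 0 Ω₂))
  (hΩ : ∀ i j, Ω i j = Ω j i) (hpos : (Matrix.of fun i j => (Ω i j).im).PosDef)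
  (Φ : (Fin (n₁ + n₂) ⊕ Fin (n₁ + n₂) → ℝ) ≃L[ℝ] (Fin (n₁ + n₂) → ℂ))
  (hΦ : ∀ v i, Φ v i = (v (Sum.inl i) : ℂ) + ∑ j, Ω i j * (v (Sum.inr j) : ℂ))
  (hΩ₁ : ∀ i j, Ω₁ i j = Ω₁ j i) (hpos₁ : (Matrix.of fun i j => (Ω₁ i j).im).PosDef)
  (Φ₁ : (Fin n₁ ⊕ Fin n₁ → ℝ) ≃L[ℝ] (Fin n₁ → ℂ))
  (hΦ₁ : ∀ v i, Φ₁ v i = (v (Sum.inl i) : ℂ) + ∑ j, Ω₁ i j * (v (Sum.inr j) : ℂ))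
  (hΩ₂ : ∀ i j, Ω₂ i j = Ω₂ j i) (hpos₂ : (Matrix.of fun i j => (Ω₂ i j).im).PosDef)
  (Φ₂ : (Fin n₂ ⊕ Fin n₂ → ℝ) ≃L[ℝ] (Fin n₂ → ℂ))
  (hΦ₂ : ∀ v i, Φ₂ v i = (v (Sum.inl i) : ℂ) + ∑ j, Ω₂ i j * (v (Sum.inr j) : ℂ))

/-! ### The relabelling of lattice coordinates -/

/-- The relabelling `e` sends `inl (castAdd i) ↦ inl (inl i)` (real periods of the first factor).
[folklore] -/
private theorem relabel_symm_inl_inl (i : Fin n₁) :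
    ((Equiv.sumCongr finSumFinEquiv.symm finSumFinEquiv.symm).trans
        (Equiv.sumSumSumComm (Fin n₁) (Fin n₂) (Fin n₁) (Fin n₂))).symm (Sum.inl (Sum.inl i)) =
      (Sum.inl (Fin.castAdd n₂ i) : Fin (n₁ + n₂) ⊕ Fin (n₁ + n₂)) := by
  simp [Equiv.sumSumSumComm]

/-- `e⁻¹ (inl (inr i)) = inr (castAdd i)` (the `Ω`-periods of the first factor). [folklore] -/
private theorem relabel_symm_inl_inr (i : Fin n₁) :
    ((Equiv.sumCongr finSumFinEquiv.symm finSumFinEquiv.symm).trans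
        (Equiv.sumSumSumComm (Fin n₁) (Fin n₂) (Fin n₁) (Fin n₂))).symm (Sum.inl (Sum.inr i)) =
      (Sum.inr (Fin.castAdd n₂ i) : Fin (n₁ + n₂) ⊕ Fin (n₁ + n₂)) := by
  simp [Equiv.sumSumSumComm]

/-- `e⁻¹ (inr (inl j)) = inl (natAdd j)`. [folklore] -/
private theorem relabel_symm_inr_inl (j : Fin n₂) :
    ((Equiv.sumCongr finSumFinEquiv.symm finSumFinEquiv.symm).trans
        (Equiv.sumSumSumComm (Fin n₁) (Fin n₂) (Fin n₁) (Fin n₂))).symm (Sum.inr (Sum.inl j)) =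
      (Sum.inl (Fin.natAdd n₁ j) : Fin (n₁ + n₂) ⊕ Fin (n₁ + n₂)) := by
  simp [Equiv.sumSumSumComm]

/-- `e⁻¹ (inr (inr j)) = inr (natAdd j)`. [folklore] -/
private theorem relabel_symm_inr_inr (j : Fin n₂) :
    ((Equiv.sumCongr finSumFinEquiv.symm finSumFinEquiv.symm).trans
        (Equiv.sumSumSumComm (Fin n₁) (Fin n₂) (Fin n₁) (Fin n₂))).symm (Sum.inr (Sum.inr j)) =
      (Sum.inr (Fin.natAdd n₁ j) : Fin (n₁ + n₂) ⊕ Fin (n₁ + n₂)) := by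
  simp [Equiv.sumSumSumComm]

/-- The relabelled coordinate vector restricted to the first factor is `a|₁ = a ∘ Sum.map castAdd castAdd`.
[folklore] -/
private theorem relabel_fst (a : Fin (n₁ + n₂) ⊕ Fin (n₁ + n₂) → ℝ) :
    (fun k : Fin n₁ ⊕ Fin n₁ ↦ a (((Equiv.sumCongr finSumFinEquiv.symm finSumFinEquiv.symm).trans
        (Equiv.sumSumSumComm (Fin n₁) (Fin n₂) (Fin n₁) (Fin n₂))).symm (Sum.inl k))) =
      a ∘ Sum.map (Fin.castAdd n₂) (Fin.castAdd n₂) := by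
  funext k
  rcases k with i | i
  · rw [relabel_symm_inl_inl]; rfl
  · rw [relabel_symm_inl_inr]; rfl

/-- The relabelled coordinate vector restricted to the second factor is `a|₂ = a ∘ Sum.map natAdd natAdd`.
[folklore] -/
private theorem relabel_snd (a : Fin (n₁ + n₂) ⊕ Fin (n₁ + n₂) → ℝ) :
    (fun k : Fin n₂ ⊕ Fin n₂ ↦ a (((Equiv.sumCongr finSumFinEquiv.symm finSumFinEquiv.symm).trans
        (Equiv.sumSumSumComm (Fin n₁) (Fin n₂) (Fin n₁) (Fin n₂))).symm (Sum.inr k))) =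
      a ∘ Sum.map (Fin.natAdd n₁) (Fin.natAdd n₁) := by
  funext k
  rcases k with j | j
  · rw [relabel_symm_inr_inl]; rfl
  · rw [relabel_symm_inr_inr]; rfl

/-- `Q P = 1` for the permutation matrices `P = reindexMatrix e`, `Q = reindexMatrixInv e` of a bijection
`e` (cf. `reindexMatrixInv_mul_reindexMatrix` of `ComplexTorusIsogenousCMPower.lean`; reproved to keep the
imports light). [folklore] -/
private theorem reindexMatrixInv_mul_reindexMatrix' {ι ι' : Type*} [Fintype ι] [Fintype ι']
    [DecidableEq ι] [DecidableEq ι'] (e : ι ≃ ι') : reindexMatrixInv e * reindexMatrix e = 1 := by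
  ext i i'
  simp only [Matrix.mul_apply, reindexMatrixInv, reindexMatrix, Matrix.of_apply, Matrix.one_apply]
  rw [Finset.sum_eq_single (e i) (fun j _ hj ↦ by simp [Ne.symm hj]) (fun h ↦ absurd (Finset.mem_univ _) h)]
  by_cases h : i = i'
  · subst h; simp
  · simp [h, Ne.symm h]

/-- `P Q = 1` for the permutation matrices of a bijection `e` (cf. `reindexMatrix_mul_reindexMatrixInv`).
[folklore] -/
private theorem reindexMatrix_mul_reindexMatrixInv' {ι ι' : Type*} [Fintype ι] [Fintype ι']
    [DecidableEq ι] [DecidableEq ι'] (e : ι ≃ ι') : reindexMatrix e * reindexMatrixInv e = 1 := by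
  ext j j'
  simp only [Matrix.mul_apply, reindexMatrixInv, reindexMatrix, Matrix.of_apply, Matrix.one_apply]
  rw [Finset.sum_eq_single (e.symm j) (fun i _ hi ↦ by
      have : e i ≠ j := fun h ↦ hi (by rw [← h, Equiv.symm_apply_apply])
      simp [this]) (fun h ↦ absurd (Finset.mem_univ _) h)]
  by_cases h : j = j'
  · subst h; simp
  · simp [h]

/-! ### The isomorphism -/

include hΩb hΦ hΦ₁ hΦ₂ in
/-- **`X_{Ω₁ ⊕ Ω₂} ≅ X_{Ω₁} × X_{Ω₂}` as complex tori.** The Siegel torus of the decomposable period matrix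
`Ω = Ω₁ ⊕ Ω₂` is isomorphic (biholomorphic group isomorphism, `IsIsomorphic`) to the product torus
`ComplexTorus (prodPeriod Φ₁ Φ₂)` of the Siegel tori of the blocks: relabel the lattice basis
`(e, Ωe) ↦ ((e₁, Ω₁e₁), (e₂, Ω₂e₂))` and identify `ℂ^{n₁+n₂} = ℂ^{n₁} × ℂ^{n₂}` `ℂ`-linearly
("`X × X' = V × V'/Λ × Λ'`"; "`(A, Θ) = (A′, Θ′) × (A″, Θ″)`").
[cite: Lange2023AbelianVarietiesComplex, §1.1.2 and §1.1.6 Exercise (5)(b), pp. 19–21, 27]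
[cite: GrushevskyXie2025, Remark 6.2 (p0034)] -/
theorem isIsomorphic_prodPeriod_of_blockDiag : IsIsomorphic Φ (prodPeriod Φ₁ Φ₂) := by
  set e := (Equiv.sumCongr finSumFinEquiv.symm finSumFinEquiv.symm).trans
    (Equiv.sumSumSumComm (Fin n₁) (Fin n₂) (Fin n₁) (Fin n₂)) with he
  refine isIsomorphic_of_matrix (reindexMatrixInv_mul_reindexMatrix' e)
    (reindexMatrix_mul_reindexMatrixInv' e)
    ((ContinuousLinearMap.pi fun i : Fin n₁ ↦
        ContinuousLinearMap.proj (R := ℂ) (φ := fun _ : Fin (n₁ + n₂) ↦ ℂ) (Fin.castAdd n₂ i)).prod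
      (ContinuousLinearMap.pi fun j : Fin n₂ ↦
        ContinuousLinearMap.proj (R := ℂ) (φ := fun _ : Fin (n₁ + n₂) ↦ ℂ) (Fin.natAdd n₁ j)))
    fun a ↦ ?_
  have hre : ((reindexMatrix e).map (Int.cast : ℤ → ℝ)).mulVec a = fun k ↦ a (e.symm k) :=
    funext (reindexMatrix_mulVec e a)
  rw [hre, he, prodPeriod_apply, relabel_fst, relabel_snd, ContinuousLinearMap.prod_apply]
  refine Prod.ext (funext fun i ↦ ?_) (funext fun i ↦ ?_)
  · simp only [ContinuousLinearMap.pi_apply, ContinuousLinearMap.proj_apply]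
    exact (apply_castAdd_eq Ω₁ Ω₂ hΩb Φ hΦ Φ₁ hΦ₁ a i).symm
  · simp only [ContinuousLinearMap.pi_apply, ContinuousLinearMap.proj_apply]
    exact (apply_natAdd_eq Ω₁ Ω₂ hΩb Φ hΦ Φ₂ hΦ₂ a i).symm

/-- **The isomorphism is `x ↦ (p₁ x, p₂ x)`**: the homomorphism `ρ(P_e) = mapMatrix (reindexMatrix e)` of
the relabelling, followed by the tautological `prodHomeomorph`, is the pair of coordinate projections
`pᵢ = mapMatrix Φ Φᵢ (1.submatrix (Sum.map …) id)` of `SiegelTorusThetaDivisorProduct.lean`.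
[cite: Lange2023AbelianVarietiesComplex, §1.1.2, pp. 19–21] -/
theorem prodHomeomorph_mapMatrix_reindexMatrix (x : ComplexTorus Φ) :
    prodHomeomorph Φ₁ Φ₂ (mapMatrix Φ (prodPeriod Φ₁ Φ₂)
        (reindexMatrix ((Equiv.sumCongr finSumFinEquiv.symm finSumFinEquiv.symm).trans
          (Equiv.sumSumSumComm (Fin n₁) (Fin n₂) (Fin n₁) (Fin n₂)))) x) =
      (mapMatrix Φ Φ₁ ((1 : Matrix _ _ ℤ).submatrix (Sum.map (Fin.castAdd n₂) (Fin.castAdd n₂)) id) x,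
        mapMatrix Φ Φ₂ ((1 : Matrix _ _ ℤ).submatrix (Sum.map (Fin.natAdd n₁) (Fin.natAdd n₁)) id) x) := by
  obtain ⟨a, rfl⟩ : ∃ a, x = proj Φ a := by
    obtain ⟨v, rfl⟩ := cover_surjective Φ x
    exact ⟨Φ.symm v, rfl⟩
  have hre : ((reindexMatrix ((Equiv.sumCongr finSumFinEquiv.symm finSumFinEquiv.symm).trans
      (Equiv.sumSumSumComm (Fin n₁) (Fin n₂) (Fin n₁) (Fin n₂)))).map (Int.cast : ℤ → ℝ)).mulVec a =
      fun k ↦ a (((Equiv.sumCongr finSumFinEquiv.symm finSumFinEquiv.symm).trans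
        (Equiv.sumSumSumComm (Fin n₁) (Fin n₂) (Fin n₁) (Fin n₂))).symm k) :=
    funext (reindexMatrix_mulVec _ a)
  rw [mapMatrix_proj, hre, prodHomeomorph_proj, mapMatrix_submatrix_one, mapMatrix_submatrix_one]
  refine Prod.ext (funext fun k ↦ ?_) (funext fun k ↦ ?_)
  · rcases k with i | i
    · simp [proj_apply]
    · simp [proj_apply]
  · rcases k with j | j
    · simp [proj_apply]
    · simp [proj_apply]

/-- **`x ↦ (p₁ x, p₂ x) : X_{Ω₁ ⊕ Ω₂} → X_{Ω₁} × X_{Ω₂}` is a bijection** (every pair of lattice coordinate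
vectors of the factors is the pair of restrictions of a unique coordinate vector).
[cite: Lange2023AbelianVarietiesComplex, §1.1.2, pp. 19–21] -/
theorem bijective_prodProjections :
    Function.Bijective fun x : ComplexTorus Φ ↦
      ((mapMatrix Φ Φ₁ ((1 : Matrix _ _ ℤ).submatrix (Sum.map (Fin.castAdd n₂) (Fin.castAdd n₂)) id) x,
        mapMatrix Φ Φ₂ ((1 : Matrix _ _ ℤ).submatrix (Sum.map (Fin.natAdd n₁) (Fin.natAdd n₁)) id) x) :
        ComplexTorus Φ₁ × ComplexTorus Φ₂) := by
  set e := (Equiv.sumCongr finSumFinEquiv.symm finSumFinEquiv.symm).trans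
    (Equiv.sumSumSumComm (Fin n₁) (Fin n₂) (Fin n₁) (Fin n₂)) with he
  -- the map is `prodHomeomorph ∘ (x ↦ x ∘ e⁻¹)` on lattice coordinates
  have hF : (fun x : ComplexTorus Φ ↦
      ((mapMatrix Φ Φ₁ ((1 : Matrix _ _ ℤ).submatrix (Sum.map (Fin.castAdd n₂) (Fin.castAdd n₂)) id) x,
        mapMatrix Φ Φ₂ ((1 : Matrix _ _ ℤ).submatrix (Sum.map (Fin.natAdd n₁) (Fin.natAdd n₁)) id) x) :
        ComplexTorus Φ₁ × ComplexTorus Φ₂)) =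
      (prodHomeomorph Φ₁ Φ₂) ∘ fun x : ComplexTorus Φ ↦
        (fun k ↦ x (e.symm k) : ComplexTorus (prodPeriod Φ₁ Φ₂)) := by
    funext x
    rw [mapMatrix_submatrix_one, mapMatrix_submatrix_one, Function.comp_apply, prodHomeomorph_apply]
    refine Prod.ext (funext fun k ↦ ?_) (funext fun k ↦ ?_)
    · change x (Sum.map (Fin.castAdd n₂) (Fin.castAdd n₂) k) = x (e.symm (Sum.inl k))
      rcases k with i | i
      · rw [he, relabel_symm_inl_inl]; rfl
      · rw [he, relabel_symm_inl_inr]; rfl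
    · change x (Sum.map (Fin.natAdd n₁) (Fin.natAdd n₁) k) = x (e.symm (Sum.inr k))
      rcases k with j | j
      · rw [he, relabel_symm_inr_inl]; rfl
      · rw [he, relabel_symm_inr_inr]; rfl
  rw [hF]
  refine (prodHomeomorph Φ₁ Φ₂).bijective.comp ?_
  exact (Equiv.piCongrLeft' (fun _ ↦ AddCircle (1 : ℝ)) e).bijective

/-! ### The polarisations: `E_Ω = p₁^*E_{Ω₁} + p₂^*E_{Ω₂}` -/

include hΩb hΦ hΦ₁ hΦ₂ in
/-- **The principal polarisation of `X_{Ω₁ ⊕ Ω₂}` is the product polarisation.** Under the analytic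
representation `z ↦ (z|_{ℂ^{n₁}}, z|_{ℂ^{n₂}})` of the isomorphism `X_Ω ≅ X_{Ω₁} × X_{Ω₂}` the Riemann form
`E_Ω` of the principally polarised Siegel torus (`siegelTwoForm 1 Φ`, type `(1, …, 1)`) is the product
form `p₁^*E_{Ω₁} + p₂^*E_{Ω₂}` (`prodForm`, `ComplexTorusProduct.lean`): so
`(X_Ω, E_Ω) ≅ (X_{Ω₁}, E_{Ω₁}) × (X_{Ω₂}, E_{Ω₂})` as polarised abelian varieties —
"`(A, Θ) = (A′, Θ′) × (A″, Θ″)`" (the symplectic basis of `ℤ^{2(n₁+n₂)}` is the concatenation of those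
of the factors). [cite: GrushevskyXie2025, Remark 6.2 (p0034)]
[cite: Lange2023AbelianVarietiesComplex, Cor. 2.4.24] -/
theorem siegelTwoForm_blockDiag_eq_prodForm (v w : Fin (n₁ + n₂) → ℂ) :
    siegelTwoForm 1 Φ ![v, w] =
      prodForm (siegelTwoForm 1 Φ₁) (siegelTwoForm 1 Φ₂)
        ![(fun i ↦ v (Fin.castAdd n₂ i), fun i ↦ v (Fin.natAdd n₁ i)),
          (fun i ↦ w (Fin.castAdd n₂ i), fun i ↦ w (Fin.natAdd n₁ i))] := by
  obtain ⟨a, rfl⟩ : ∃ a, v = Φ a := ⟨Φ.symm v, (Φ.apply_symm_apply v).symm⟩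
  obtain ⟨b, rfl⟩ : ∃ b, w = Φ b := ⟨Φ.symm w, (Φ.apply_symm_apply w).symm⟩
  have ha₁ : (fun i ↦ Φ a (Fin.castAdd n₂ i)) = Φ₁ (a ∘ Sum.map (Fin.castAdd n₂) (Fin.castAdd n₂)) :=
    funext (apply_castAdd_eq Ω₁ Ω₂ hΩb Φ hΦ Φ₁ hΦ₁ a)
  have ha₂ : (fun i ↦ Φ a (Fin.natAdd n₁ i)) = Φ₂ (a ∘ Sum.map (Fin.natAdd n₁) (Fin.natAdd n₁)) :=
    funext (apply_natAdd_eq Ω₁ Ω₂ hΩb Φ hΦ Φ₂ hΦ₂ a)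
  have hb₁ : (fun i ↦ Φ b (Fin.castAdd n₂ i)) = Φ₁ (b ∘ Sum.map (Fin.castAdd n₂) (Fin.castAdd n₂)) :=
    funext (apply_castAdd_eq Ω₁ Ω₂ hΩb Φ hΦ Φ₁ hΦ₁ b)
  have hb₂ : (fun i ↦ Φ b (Fin.natAdd n₁ i)) = Φ₂ (b ∘ Sum.map (Fin.natAdd n₁) (Fin.natAdd n₁)) :=
    funext (apply_natAdd_eq Ω₁ Ω₂ hΩb Φ hΦ Φ₂ hΦ₂ b)
  rw [ha₁, ha₂, hb₁, hb₂, prodForm_apply]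
  simp only [siegelTwoForm, twoForm_apply_apply, sympFormTypeD_apply, Function.comp_apply, Sum.map_inl,
    Sum.map_inr, Pi.one_apply, Nat.cast_one, one_mul]
  exact Fin.sum_univ_add _

/-! ### The theta divisor inside the product -/

include hΩb hpos₁ hpos₂ hΦ₁ hΦ₂ in
/-- **`Θ_{X₁ × X₂} = (Θ₁ × X₂) ∪ (X₁ × Θ₂)` as a preimage**: the theta divisor of `X_{Ω₁ ⊕ Ω₂}` is the
preimage of `Θ₁ ×ˢ univ ∪ univ ×ˢ Θ₂ ⊂ X₁ × X₂` under `x ↦ (p₁ x, p₂ x)`.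
[cite: GrushevskyXie2025, Remark 6.2 (p0034)] -/
theorem preimage_thetaDivisor_prod_union :
    (fun x : ComplexTorus Φ ↦
      ((mapMatrix Φ Φ₁ ((1 : Matrix _ _ ℤ).submatrix (Sum.map (Fin.castAdd n₂) (Fin.castAdd n₂)) id) x,
        mapMatrix Φ Φ₂ ((1 : Matrix _ _ ℤ).submatrix (Sum.map (Fin.natAdd n₁) (Fin.natAdd n₁)) id) x) :
        ComplexTorus Φ₁ × ComplexTorus Φ₂)) ⁻¹'
        (thetaDivisor Ω₁ hΩ₁ hpos₁ Φ₁ hΦ₁ ×ˢ univ ∪ univ ×ˢ thetaDivisor Ω₂ hΩ₂ hpos₂ Φ₂ hΦ₂) =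
      thetaDivisor Ω hΩ hpos Φ hΦ := by
  rw [thetaDivisor_blockDiag_eq_union Ω₁ Ω₂ hΩb hΩ hpos Φ hΦ hΩ₁ hpos₁ Φ₁ hΦ₁ hΩ₂ hpos₂ Φ₂ hΦ₂]
  ext x
  simp

include hΩb hpos₁ hpos₂ hΦ₁ hΦ₂ in
/-- **`Θ_{X₁ × X₂} = (Θ₁ × X₂) ∪ (X₁ × Θ₂)` inside `X₁ × X₂`**: the bijection `x ↦ (p₁ x, p₂ x)` (the
isomorphism `X_{Ω₁ ⊕ Ω₂} ≅ X_{Ω₁} × X_{Ω₂}`) carries the theta divisor of the product principally polarised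
abelian variety ONTO `Θ₁ ×ˢ X₂ ∪ X₁ ×ˢ Θ₂` — "if `(A, Θ) = (A′, Θ′) × (A″, Θ″)`, then the theta divisor
`Θ = (Θ′ × A″) ∪ (A′ × Θ″)` is reducible". [cite: GrushevskyXie2025, Remark 6.2 (p0034)] -/
theorem image_thetaDivisor_blockDiag :
    (fun x : ComplexTorus Φ ↦
      ((mapMatrix Φ Φ₁ ((1 : Matrix _ _ ℤ).submatrix (Sum.map (Fin.castAdd n₂) (Fin.castAdd n₂)) id) x,
        mapMatrix Φ Φ₂ ((1 : Matrix _ _ ℤ).submatrix (Sum.map (Fin.natAdd n₁) (Fin.natAdd n₁)) id) x) :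
        ComplexTorus Φ₁ × ComplexTorus Φ₂)) '' thetaDivisor Ω hΩ hpos Φ hΦ =
      thetaDivisor Ω₁ hΩ₁ hpos₁ Φ₁ hΦ₁ ×ˢ univ ∪ univ ×ˢ thetaDivisor Ω₂ hΩ₂ hpos₂ Φ₂ hΦ₂ := by
  rw [← preimage_thetaDivisor_prod_union Ω₁ Ω₂ hΩb hΩ hpos Φ hΦ hΩ₁ hpos₁ Φ₁ hΦ₁ hΩ₂ hpos₂ Φ₂ hΦ₂]
  exact Set.image_preimage_eq _ (bijective_prodProjections Φ Φ₁ Φ₂).surjective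

end Product

end ComplexTorus

end Literature.Geometry.Kaehler

end
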